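import Summits.ResolutionOfSingularities.ResolutionOfSingularities.Theorems.FreezeCutConeVars
import HarnessLib

/-!
# FreezeCutLaw — decomp-res node «FreezeCut» (lens-3 g19 rev 2, critic rows 149/149a/149b), tree file 2/5 of the node

Content VERBATIM from the decomp-res lens-3 g19 TREE-FACING COMPANION
`HOME/decomp-res-lens-3/g19/tree/FreezeCutTree.lean` (rev 3 pin
7e31fb5a…; = node `FreezeCut.lean` rev 2 pin c7927053 NEW PART ONLY; HOME = run/shared/lean/pub/decomp-res).
Critic: CRITIC-LEDGER rows 149 / 149a /
149b CLEARED (orders 2026-08-30T22:14:37Z / 22:25:58Z / 22:27:55Z).  Landed by decomp-res writer g8 as five files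
— `FreezeCutConeVars` (§V),
`FreezeCutLaw` (§F), `FreezeCutHalf` (§H) [namespace `…Theorems.HoleCut`, in-cone behind
`MaxContactCutHoleCut`], `FreezeCutClasses` (cone-free
classes of §K5/§K6; carries the full landing note and the companion description) and the wiring file
`MaxContactCutFreezeCut` — all
`--supports stmt-ResolutionOfSingularities-31770`.

§F THE FREEZING LAW (g19): SUPERCRITICAL JOINT TAILS ARE PLANAR — `TailShade.no_joint'` & co. (namespace
`…Theorems.HoleCut.TailShade`,
invoked by explicit application).  PROVED, 0 sorry, standard axioms (critic row 149: `--axioms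
HoleCut.TailShade.no_joint'`).  Imports `FreezeCutConeVars`.

[WRITER NOTE (decomp-res writer g8): section split only; namespaces, opens, section variables and every declaration
exactly as in the
companion (its global `linter.dupNamespace` option line dropped).]

(Sources: Hauser2010; Moh1987; CossartPiltant2008I; BenitoVillamayor2012; KawanoueMatsuki2010; HironakaBowdoin2005.)
-/

noncomputable section

open MvPolynomial Finset
open Literature.AlgebraicGeometry.Resolution
open Literature.AlgebraicGeometry.Resolution.Hauser2010
open Literature.AlgebraicGeometry.Resolution.PointBlowup
open Summit.ResolutionOfSingularities.ResolutionOfSingularities.Theses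
open Summit.ResolutionOfSingularities.ResolutionOfSingularities.Theorems.TightDefectClasses
open Summit.ResolutionOfSingularities.ResolutionOfSingularities.Theorems.TightDefectStrongWalks
open Summit.ResolutionOfSingularities.ResolutionOfSingularities.Theorems.ItineraryCutClasses
open Summit.ResolutionOfSingularities.ResolutionOfSingularities.Theorems.BoundaryLedger
open Summit.ResolutionOfSingularities.ResolutionOfSingularities.Theorems.ProximityCut
open Summit.ResolutionOfSingularities.ResolutionOfSingularities.Theorems.ConeCutAxisLaw
open Literature.AlgebraicGeometry.Resolution.WeightedBlowup
open Literature.Barriers.ResolutionOfSingularities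
open Summit.ResolutionOfSingularities.ResolutionOfSingularities.Theorems.FloorCut
open Summit.ResolutionOfSingularities.ResolutionOfSingularities.Theorems.ConeCut
open Summit.ResolutionOfSingularities.ResolutionOfSingularities.Theorems.ExitLaw (fin3_cases eq_of_le_of_degree_le)
open Summit.ResolutionOfSingularities.ResolutionOfSingularities.Theorems.ShadeCut
open Summit.ResolutionOfSingularities.ResolutionOfSingularities.Theorems.TightCut
open Summit.ResolutionOfSingularities.ResolutionOfSingularities.Theorems.HoleCut

namespace Summit.ResolutionOfSingularities.ResolutionOfSingularities.Theorems.HoleCut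

/-! ## §F THE FREEZING LAW (g19) — SUPERCRITICAL JOINT TAILS ARE PLANAR

On a tail of shade `n ≥ 1` with positive excess at a modulus `q ≥ 3n − 2` (SUPERCRITICAL; every shade at once):
(F1) the alternative «two cone variables, or a dead support» is preserved by every move (V1, V2, V3′, V4 and the
multiplicity ledger); (F2) a translated move from such a stage leaves a DEAD SUPPORT (a cone variable of multiplicity
`0`), and dead supports persist; (F3) between two poor stages, with a dead support at the second, the next move is NOT
a proximity repeat: a repeat goes into the dead support `x` or into the third coordinate `w`; into `w`, or into `x`
with a translation (necessarily along `w`), it keeps only the newest mass `≤ n − 1`, so `|r| ≤ 2n − 2 < q + 1 − n`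
(deficit window); into `x` untranslated it is forbidden by (V1).  Hence (F4) a joint tail (repeats AND translations
recur) never has two cone variables: its residual cone is a pure power `c_t·u_k^n` of ONE coordinate `k`, the same for
all `t ≥ N` (V2, V4), never charted and never translated (V2, V3) — the tail is PLANAR in lens-5's letters
(`∀ t ≥ N, j_t ≠ k ∧ b_t(k) = 0`). -/

section Freezing

variable {K : Type} [Field K] [DecidableEq K] {q : ℕ} {s₀ : State (Fin 3) K}

namespace TailShade

variable {W : ForcedWalk q s₀} {N n : ℕ}

/-- The plateau-step data of a tail stage, in the shape the §V rules consume. [folklore] -/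
theorem stage (hroot : IsRoot q s₀) (h : TailShade W N n) (t : ℕ) (ht : N ≤ t) :
    ∃ o : ℕ, ordZero (W.st t).F = o ∧ q < o ∧ (W.st (t + 1)).shade = (W.st t).shade ∧
      (W.st t).shade = (n : ℕ∞) ∧ o = n + (W.st t).r.degree := by
  obtain ⟨o, ho, hqo, -, hod⟩ := h.order hroot t ht
  refine ⟨o, ho, hqo, ?_, h.shade_eq t ht, hod⟩
  rw [h.plat t ht]

/-- (V4) on the tail. [folklore] -/
theorem persist (hroot : IsRoot q s₀) (h : TailShade W N n) (t : ℕ) (ht : N ≤ t) {x : Fin 3} (hx : x ≠ W.j t)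
    (hc : ConeVar W t x) : ConeVar W (t + 1) x := by
  obtain ⟨o, ho, hqo, hplat, hn, -⟩ := h.stage hroot t ht
  exact coneVar_succ hroot W t ho hqo hplat hn hx hc

/-- A dead support off the chart stays dead. [folklore] -/
theorem dead_succ_of_ne (hroot : IsRoot q s₀) (h : TailShade W N n) (t : ℕ) (ht : N ≤ t) {x : Fin 3}
    (hx : x ≠ W.j t) (hd : DeadSupport W t x) : DeadSupport W (t + 1) x := by
  obtain ⟨-, -, hkeep⟩ := h.step hroot t ht
  refine ⟨h.persist hroot t ht hx hd.1, ?_⟩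
  rw [hkeep x hx, kept_of_ne W t hx]
  split_ifs
  · exact hd.2
  · rfl

/-- **(F2) A TRANSLATED MOVE FROM A «TWO-OR-DEAD» STAGE LEAVES A DEAD SUPPORT (PROVED).** [new] [folklore] -/
theorem dead_succ_of_translated (hroot : IsRoot q s₀) (hn1 : 1 ≤ n) (h : TailShade W N n) (t : ℕ) (ht : N ≤ t)
    (hJ : TwoConeVars W t ∨ ∃ x, DeadSupport W t x) (hb : W.b t ≠ 0) : ∃ x, DeadSupport W (t + 1) x := by
  classical
  obtain ⟨o, ho, hqo, hplat, hn, -⟩ := h.stage hroot t ht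
  obtain ⟨-, -, hkeep⟩ := h.step hroot t ht
  -- (a) a translated cone variable off the chart dies at once
  by_cases hA : ∃ x, x ≠ W.j t ∧ ConeVar W t x ∧ W.b t x ≠ 0
  · obtain ⟨x, hxj, hcx, hbx⟩ := hA
    exact ⟨x, h.persist hroot t ht hxj hcx, by rw [hkeep x hxj, kept_of_ne W t hxj, if_neg hbx]⟩
  push Not at hA
  -- (b) a translated coordinate `z`; by (a) it is not a cone variable
  obtain ⟨z, hbz⟩ : ∃ z, W.b t z ≠ 0 := by
    by_contra hall
    push Not at hall
    exact hb (funext hall)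
  have hzj : z ≠ W.j t := fun h' => hbz (by rw [h']; exact W.onExc t)
  have hcz : ¬ ConeVar W t z := fun hc => hbz (hA z hzj hc)
  obtain ⟨w, hwj, hwz⟩ := exists_third hzj.symm
  by_cases hbw : W.b t w = 0
  · -- single translation along `z`: the chart is not a cone variable (V3′)
    have hby : ∀ y, y ≠ z → W.b t y = 0 := by
      intro y hy
      rcases fin3_cases hzj.symm hwj hwz y with hl | hl | hl
      · rw [hl]; exact W.onExc t
      · exact absurd hl hy
      · rw [hl]; exact hbw
    have hcj : ¬ ConeVar W t (W.j t) := fun hc =>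
      hcz (coneVar_of_single_translation hroot W t ho hqo hplat hn hby hc)
    rcases hJ with ⟨x, y, hxy, hcx, hcy⟩ | ⟨k, hck, hrk⟩
    · exfalso
      have hxw : x = w := by
        rcases fin3_cases hzj.symm hwj hwz x with hl | hl | hl
        · rw [hl] at hcx; exact absurd hcx hcj
        · rw [hl] at hcx; exact absurd hcx hcz
        · exact hl
      have hyw : y = w := by
        rcases fin3_cases hzj.symm hwj hwz y with hl | hl | hl
        · rw [hl] at hcy; exact absurd hcy hcj
        · rw [hl] at hcy; exact absurd hcy hcz
        · exact hl
      exact hxy (hxw.trans hyw.symm)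
    · have hkj : k ≠ W.j t := by
        intro h'
        rw [h'] at hck
        exact hcj hck
      exact ⟨k, h.dead_succ_of_ne hroot t ht hkj ⟨hck, hrk⟩⟩
  · -- double translation along `z` and `w`, neither a cone variable: contradicts (V2)
    exfalso
    have hcw : ¬ ConeVar W t w := fun hc => hbw (hA w hwj hc)
    obtain ⟨x, hxj, hcx⟩ := exists_coneVar_ne_chart hroot W t ho hqo hplat hn hn1
    rcases fin3_cases hzj.symm hwj hwz x with hl | hl | hl
    · exact hxj hl
    · rw [hl] at hcx; exact hcz hcx
    · rw [hl] at hcx; exact hcw hcx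

/-- Dead supports persist (F2). [new] [folklore] -/
theorem dead_succ (hroot : IsRoot q s₀) (hn1 : 1 ≤ n) (h : TailShade W N n) (t : ℕ) (ht : N ≤ t)
    (hD : ∃ x, DeadSupport W t x) : ∃ x, DeadSupport W (t + 1) x := by
  classical
  by_cases hb : W.b t = 0
  · obtain ⟨o, ho, hqo, hplat, hn, -⟩ := h.stage hroot t ht
    have hcj := not_coneVar_chart_of_untranslated hroot W t ho hqo hplat hn hb
    obtain ⟨k, hck, hrk⟩ := hD
    have hkj : k ≠ W.j t := by
      intro h'
      rw [h'] at hck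
      exact hcj hck
    exact ⟨k, h.dead_succ_of_ne hroot t ht hkj ⟨hck, hrk⟩⟩
  · exact h.dead_succ_of_translated hroot hn1 t ht (Or.inr hD) hb

/-- **(F1) «TWO CONE VARIABLES OR A DEAD SUPPORT» IS PRESERVED (PROVED).** [new] [folklore] -/
theorem twoOrDead_succ (hroot : IsRoot q s₀) (hn1 : 1 ≤ n) (h : TailShade W N n) (t : ℕ) (ht : N ≤ t)
    (hJ : TwoConeVars W t ∨ ∃ x, DeadSupport W t x) : TwoConeVars W (t + 1) ∨ ∃ x, DeadSupport W (t + 1) x := by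
  classical
  rcases hJ with ⟨x, y, hxy, hcx, hcy⟩ | hD
  · by_cases hb : W.b t = 0
    · obtain ⟨o, ho, hqo, hplat, hn, -⟩ := h.stage hroot t ht
      have hcj := not_coneVar_chart_of_untranslated hroot W t ho hqo hplat hn hb
      have hxj : x ≠ W.j t := by
        intro h'
        rw [h'] at hcx
        exact hcj hcx
      have hyj : y ≠ W.j t := by
        intro h'
        rw [h'] at hcy
        exact hcj hcy
      exact Or.inl ⟨x, y, hxy, h.persist hroot t ht hxj hcx, h.persist hroot t ht hyj hcy⟩
    · exact Or.inr (h.dead_succ_of_translated hroot hn1 t ht (Or.inl ⟨x, y, hxy, hcx, hcy⟩) hb)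
  · exact Or.inr (h.dead_succ hroot hn1 t ht hD)

/-- **(F3) NO PROXIMITY REPEAT BEHIND A DEAD SUPPORT (PROVED, `q ≥ 3n − 2`)**: if stage `t` is poor and stage
`t + 1` has a dead support, move `t + 1` is not a proximity repeat. [new] [folklore] -/
theorem not_stays_of_dead (hroot : IsRoot q s₀) (hq : 3 * n ≤ q + 2) (h : TailShade W N n) (t : ℕ) (ht : N ≤ t)
    (hz0 : HasZero W t) (hd1 : ∃ x, DeadSupport W (t + 1) x) : ¬ StaysOnNewest W t := by
  classical
  rintro ⟨hne, hbn⟩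
  obtain ⟨x, hcx, hrx⟩ := hd1
  have hD0 := degree_lt_of_hasZero hroot W t hz0
  have hD1 := degree_lt_of_hasZero hroot W (t + 1) ⟨x, hrx⟩
  obtain ⟨-, hnew, -⟩ := h.step hroot t ht
  obtain ⟨hd2, -, -⟩ := h.step hroot (t + 1) (by omega)
  rw [show t + 1 + 1 = t + 2 from rfl] at hd2
  have hw0 := h.degree_window hroot t ht
  have hw2 := h.degree_window hroot (t + 2) (by omega)
  have hxj : x ≠ W.j t := by
    intro h'
    rw [h'] at hrx
    omega
  obtain ⟨m, hmn, hmc⟩ := exists_third hne.symm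
  obtain ⟨hk, hkm⟩ := TailThree.kept_three W t hne hmn hmc hbn
  have hkm0 : kept W (t + 1) m = 0 := by
    by_cases hcx' : W.j (t + 1) = x
    · -- the chart is the dead support: untranslated is forbidden by (V1); translated ⇒ along `m`
      by_cases hb : W.b (t + 1) = 0
      · exfalso
        obtain ⟨o, ho, hqo, hplat, hn, -⟩ := h.stage hroot (t + 1) (by omega)
        refine not_coneVar_chart_of_untranslated hroot W (t + 1) ho hqo hplat hn hb ?_
        rw [hcx']
        exact hcx
      · have hbm : W.b (t + 1) m ≠ 0 := by
          intro hbm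
          apply hb
          funext l
          rcases fin3_cases hne.symm hmn hmc l with hl | hl | hl <;> rw [hl]
          · exact hbn
          · exact W.onExc (t + 1)
          · exact hbm
        rw [hkm, if_neg hbm]
    · -- the chart is the third coordinate: the dead support is `m`, of multiplicity `0`
      have hxm : x = m := by
        rcases fin3_cases hne.symm hmn hmc x with hl | hl | hl
        · exact absurd hl hxj
        · exact absurd hl.symm hcx'
        · exact hl
      rw [hkm]
      split_ifs
      · rw [← hxm]; exact hrx
      · rfl
  omega

/-- **(F4a) TWO CONE VARIABLES KILL A SUPERCRITICAL JOINT TAIL (PROVED).**  From a stage with two cone variables,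
after the next translated move every stage carries a dead support (F1, F2) and is poor, so no later move is a
proximity repeat (F3) — contradicting «repeats recur». [new] [folklore] -/
theorem no_twoConeVars (hroot : IsRoot q s₀) (hq : 3 * n ≤ q + 2) (hn1 : 1 ≤ n) (h : TailShade W N n)
    (hrep : ∀ M, ∃ t, M ≤ t ∧ StaysOnNewest W t) (htr : ∀ M, ∃ t, M ≤ t ∧ W.b t ≠ 0)
    {t₀ : ℕ} (ht₀ : N ≤ t₀) (htwo : TwoConeVars W t₀) : False := by
  classical
  have hJ : ∀ t, t₀ ≤ t → TwoConeVars W t ∨ ∃ x, DeadSupport W t x := by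
    intro t ht
    induction t, ht using Nat.le_induction with
    | base => exact Or.inl htwo
    | succ t ht ih => exact h.twoOrDead_succ hroot hn1 t (by omega) ih
  obtain ⟨t₁, ht₁, hb⟩ := htr t₀
  have hD : ∀ d, ∃ x, DeadSupport W (t₁ + 1 + d) x := by
    intro d
    induction d with
    | zero => exact h.dead_succ_of_translated hroot hn1 t₁ (by omega) (hJ t₁ ht₁) hb
    | succ d ih =>
      rw [show t₁ + 1 + (d + 1) = t₁ + 1 + d + 1 by omega]
      exact h.dead_succ hroot hn1 (t₁ + 1 + d) (by omega) ih
  obtain ⟨u, hu, hS⟩ := hrep (t₁ + 1)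
  obtain ⟨d, rfl⟩ : ∃ d, u = t₁ + 1 + d := ⟨u - (t₁ + 1), by omega⟩
  obtain ⟨x, -, hrx⟩ := hD d
  have hd1 := hD (d + 1)
  rw [show t₁ + 1 + (d + 1) = t₁ + 1 + d + 1 by omega] at hd1
  exact h.not_stays_of_dead hroot hq (t₁ + 1 + d) (by omega) ⟨x, hrx⟩ hd1 hS

/-- **(F4) THE FREEZING LAW (PROVED): ON A SUPERCRITICAL JOINT TAIL ONE COORDINATE IS FROZEN.**  On a tail of
shade `n ≥ 1`, positive excess, `q ≥ 3n − 2`, with proximity repeats AND translated moves recurring, ONE coordinate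
`k` is, from stage `N` on, THE unique cone variable (the residual cone is `c_t·u_k^n` throughout), never the chart and
never translated. [new] [folklore] -/
theorem frozen_of_joint (hroot : IsRoot q s₀) (hq : 3 * n ≤ q + 2) (hn1 : 1 ≤ n) (h : TailShade W N n)
    (hrep : ∀ M, ∃ t, M ≤ t ∧ StaysOnNewest W t) (htr : ∀ M, ∃ t, M ≤ t ∧ W.b t ≠ 0) :
    ∃ k : Fin 3, ∀ t, N ≤ t → ConeVar W t k ∧ (∀ x, ConeVar W t x → x = k) ∧ W.j t ≠ k ∧ W.b t k = 0 := by
  classical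
  have hone : ∀ t, N ≤ t → ∀ x y, ConeVar W t x → ConeVar W t y → x = y := by
    intro t ht x y hx hy
    by_contra hxy
    exact h.no_twoConeVars hroot hq hn1 hrep htr ht ⟨x, y, hxy, hx, hy⟩
  obtain ⟨o, ho, hqo, hplat, hn, -⟩ := h.stage hroot N le_rfl
  obtain ⟨k, -, hck⟩ := exists_coneVar_ne_chart hroot W N ho hqo hplat hn hn1
  refine ⟨k, ?_⟩
  have hall : ∀ t, N ≤ t → ConeVar W t k := by
    intro t ht
    induction t, ht using Nat.le_induction with
    | base => exact hck
    | succ t ht ih =>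
      obtain ⟨o, ho, hqo, hplat, hn, -⟩ := h.stage hroot t ht
      obtain ⟨x, hxj, hcx⟩ := exists_coneVar_ne_chart hroot W t ho hqo hplat hn hn1
      have hxk : x = k := hone t ht x k hcx ih
      rw [hxk] at hxj
      exact coneVar_succ hroot W t ho hqo hplat hn hxj ih
  intro t ht
  obtain ⟨o, ho, hqo, hplat, hn, -⟩ := h.stage hroot t ht
  obtain ⟨x, hxj, hcx⟩ := exists_coneVar_ne_chart hroot W t ho hqo hplat hn hn1
  have hxk : x = k := hone t ht x k hcx (hall t ht)
  rw [hxk] at hxj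
  exact ⟨hall t ht, fun y hy => hone t ht y k hy (hall t ht), fun h' => hxj h'.symm,
    b_eq_zero_of_coneVar_subset hroot W t ho hqo hplat hn hn1 hxj fun y hy => hone t ht y k hy (hall t ht)⟩

/-- **A SUPERCRITICAL JOINT TAIL IS PLANAR (PROVED)** — lens-5's letter `PlanarCut.PlanarFrom W k N`
(`∀ t ≥ N, j_t ≠ k ∧ b_t(k) = 0`) read off the freezing law. [new] [folklore] -/
theorem planar_of_joint (hroot : IsRoot q s₀) (hq : 3 * n ≤ q + 2) (hn1 : 1 ≤ n) (h : TailShade W N n)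
    (hrep : ∀ M, ∃ t, M ≤ t ∧ StaysOnNewest W t) (htr : ∀ M, ∃ t, M ≤ t ∧ W.b t ≠ 0) :
    ∃ k : Fin 3, ∀ t, N ≤ t → W.j t ≠ k ∧ W.b t k = 0 := by
  obtain ⟨k, hk⟩ := h.frozen_of_joint hroot hq hn1 hrep htr
  exact ⟨k, fun t ht => ⟨(hk t ht).2.2.1, (hk t ht).2.2.2⟩⟩

/-- **(F5) THERE ARE NO SUPERCRITICAL JOINT TAILS (PROVED, hypothesis-free, every shade at once).**  The frozen
coordinate `k` carries a CONSTANT boundary multiplicity `v = r_t(k)` (never charted, never translated).  `v ≥ 1`: a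
massive wall along a planar tail is lens-5's landed theorem `PlanarCut.noPlanarTails` (the wall potential).  `v = 0`
(GHOST WALL): `k` is a dead support at every stage, every stage is poor, and (F3) forbids every proximity repeat after
`N` — but repeats recur. [new] [folklore] -/
theorem no_joint (hroot : IsRoot q s₀) (hq : 3 * n ≤ q + 2) (hn1 : 1 ≤ n) (h : TailShade W N n)
    (hrep : ∀ M, ∃ t, M ≤ t ∧ StaysOnNewest W t) (htr : ∀ M, ∃ t, M ≤ t ∧ W.b t ≠ 0) : False := by
  classical
  obtain ⟨k, hk⟩ := h.frozen_of_joint hroot hq hn1 hrep htr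
  have hP : PlanarCut.PlanarFrom W k N := fun t ht => ⟨(hk t ht).2.2.1, (hk t ht).2.2.2⟩
  by_cases hr : 1 ≤ (W.st N).r k
  · exact PlanarCut.noPlanarTails hroot W k N hP hr hrep htr
  · have hz : ∀ t, N ≤ t → (W.st t).r k = 0 := by
      intro t ht
      induction t, ht using Nat.le_induction with
      | base => omega
      | succ t ht ih =>
        obtain ⟨-, -, hkeep⟩ := h.step hroot t ht
        rw [hkeep k (hk t ht).2.2.1.symm, kept_of_ne W t (hk t ht).2.2.1.symm, if_pos (hk t ht).2.2.2]
        exact ih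
    obtain ⟨t, ht, hS⟩ := hrep N
    exact h.not_stays_of_dead hroot hq t ht ⟨k, hz t ht⟩ ⟨k, (hk (t + 1) (by omega)).1, hz (t + 1) (by omega)⟩ hS

end TailShade

end Freezing

end Summit.ResolutionOfSingularities.ResolutionOfSingularities.Theorems.HoleCut
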